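import Mathlib
import HarnessLib
import Summits.Ventures.LatticeQCDFlow.Exactness.LatticeSiteResampling

/-!
# Coordinate averages on a finite product of probability spaces (towards Efron–Stein)

HONEST FRAMING: exact (Metropolis-corrected) sampling algorithms for lattice gauge theory;
figures of merit are autocorrelation/cost numbers at stated couplings and volumes; no
continuum-physics claim.

Venture `LatticeQCDFlow` (cell pub-lqcd), topic `Exactness`; FANOUT row 7 (`s0-cpn-null`).  NEW
WORK of the cell over Mathlib and the tree's `Exactness/LatticeSiteResampling.lean` (redrawing
one coordinate of a product measure); nothing is cited as a fact.  The operators `A_s` below are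
the conditional expectations "integrate out the coordinates in `s`" of the Efron–Stein /
tensorisation-of-variance argument [folklore; B. Efron, C. Stein, Ann. Statist. 9 (1981) 586],
carried out in `Exactness/LatticeEfronStein.lean`; the application is the volume-independent
spectral gap of Lüscher's operator `−Σ_k ∂̃_k·∂̃_k` on a lattice of spheres
(`Exactness/SphereLatticePoincare.lean`).

## Setting

`ι` a finite index set, `X` a measurable (later: compact metric) space with a probability measure
`μ`, `π = ⊗_{i∈ι} μ` on `Ω = ι → X`.  For `s ⊆ ι` the **coordinate average**
`coordAvg μ s G (ω) = ∫ G(ω' on s, ω off s) dπ(ω')` integrates out the coordinates in `s`.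

## Content

* `coordAvg`; `coordAvg_apply_piecewise` (`A_s G` does not depend on the `s`-coordinates),
  `coordAvg_mul_left` (pull out `s`-independent factors), `map_piecewise_pi_prod` (gluing two
  independent samples along `s` is measure preserving), `coordAvg_const/_empty/_univ`,
  `coordAvg_coordAvg` (`A_s A_s = A_s`).
* For continuous `G` on a compact metric `X`: `continuous_coordAvg`, **`integral_coordAvg`**
  (`E[A_s G] = E[G]`), `coordAvg_sub`, **`coordAvg_singleton`** (`A_k G(ω) = ∫ G(ω[k ← v]) dμ(v)`),
  **`coordAvg_insert`** (`A_{s ∪ {k}} = A_s ∘ A_k` for `k ∉ s`: independence of the coordinates),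
  `integral_sq_sub_mean`, **`sq_coordAvg_le`** (Jensen: `(A_s H)² ≤ A_s(H²)`),
  **`integral_sub_coordAvg_mul_eq_zero`** (orthogonality: `E[(G − A_s G)·Φ] = 0` for `Φ`
  independent of the `s`-coordinates).

NOT CLAIMED: the `L²` (non-continuous) generality; infinite products.
-/

noncomputable section

namespace Summit.Ventures.LatticeQCDFlow.Exactness

open MeasureTheory Function
open scoped ENNReal

variable {ι : Type*} [Fintype ι] [DecidableEq ι]
variable {X : Type*} [MeasurableSpace X]

/-! ## §1 Coordinate averages: measure-theoretic part -/

section CoordAvg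

/-- **The coordinate average** over `s ⊆ ι`: `coordAvg μ s G ω = ∫ G(s.piecewise ω' ω) dπ(ω')`,
`π = ⊗_i μ` — the coordinates of `ω` in `s` are integrated out against fresh independent samples,
the others are kept. -/
def coordAvg (μ : Measure X) (s : Finset ι) (G : (ι → X) → ℝ) (ω : ι → X) : ℝ :=
  ∫ ω', G (s.piecewise ω' ω) ∂Measure.pi (fun _ : ι => μ)

variable (μ : Measure X)

/-- **`A_s G` does not depend on the coordinates in `s`.** -/
theorem coordAvg_apply_piecewise (s : Finset ι) (G : (ι → X) → ℝ) (ω ω'' : ι → X) :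
    coordAvg μ s G (s.piecewise ω'' ω) = coordAvg μ s G ω := by
  unfold coordAvg
  simp only [Finset.piecewise_idem_right]

/-- Factors not depending on the `s`-coordinates come out of `A_s`. -/
theorem coordAvg_mul_left (s : Finset ι) {Φ H : (ι → X) → ℝ}
    (hΦ : ∀ ω ω', Φ (s.piecewise ω' ω) = Φ ω) (ω : ι → X) :
    coordAvg μ s (fun ω => Φ ω * H ω) ω = Φ ω * coordAvg μ s H ω := by
  unfold coordAvg
  simp_rw [hΦ]
  exact integral_const_mul _ _

omit [Fintype ι] in
/-- The gluing map `(ω, ω') ↦ s.piecewise ω' ω` is measurable. -/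
theorem measurable_piecewise_prod (s : Finset ι) :
    Measurable fun p : (ι → X) × (ι → X) => s.piecewise p.2 p.1 := by
  refine measurable_pi_iff.2 fun i => ?_
  by_cases hi : i ∈ s
  · simp only [Finset.piecewise_eq_of_mem _ _ _ hi]
    exact (measurable_pi_apply i).comp measurable_snd
  · simp only [Finset.piecewise_eq_of_notMem _ _ _ hi]
    exact (measurable_pi_apply i).comp measurable_fst

/-- `A_ι G` is the constant `E[G]`. -/
theorem coordAvg_univ (G : (ι → X) → ℝ) (ω : ι → X) :
    coordAvg μ Finset.univ G ω = ∫ ω', G ω' ∂Measure.pi (fun _ : ι => μ) := by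
  unfold coordAvg
  simp only [Finset.piecewise_univ]

variable [IsProbabilityMeasure μ]

/-- **Gluing two independent samples along `s` is measure preserving**: the push-forward of
`π ⊗ π` under `(ω, ω') ↦ s.piecewise ω' ω` is `π`. -/
theorem map_piecewise_pi_prod (s : Finset ι) :
    Measure.map (fun p : (ι → X) × (ι → X) => s.piecewise p.2 p.1)
      ((Measure.pi (fun _ : ι => μ)).prod (Measure.pi (fun _ : ι => μ))) =
      Measure.pi (fun _ : ι => μ) := by
  symm
  refine Measure.pi_eq fun t ht => ?_
  rw [Measure.map_apply (measurable_piecewise_prod s) (MeasurableSet.univ_pi ht)]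
  have hpre : (fun p : (ι → X) × (ι → X) => s.piecewise p.2 p.1) ⁻¹' Set.univ.pi t =
      (Set.univ.pi fun i => if i ∈ s then Set.univ else t i) ×ˢ
        (Set.univ.pi fun i => if i ∈ s then t i else Set.univ) := by
    ext ⟨ω, ω'⟩
    simp only [Set.mem_preimage, Set.mem_univ_pi, Set.mem_prod]
    constructor
    · intro h
      refine ⟨fun i => ?_, fun i => ?_⟩
      · by_cases hi : i ∈ s
        · simp [hi]
        · simpa [hi, Finset.piecewise_eq_of_notMem _ _ _ hi] using h i
      · by_cases hi : i ∈ s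
        · simpa [hi, Finset.piecewise_eq_of_mem _ _ _ hi] using h i
        · simp [hi]
    · rintro ⟨h1, h2⟩ i
      by_cases hi : i ∈ s
      · rw [Finset.piecewise_eq_of_mem _ _ _ hi]; simpa [hi] using h2 i
      · rw [Finset.piecewise_eq_of_notMem _ _ _ hi]; simpa [hi] using h1 i
  rw [hpre, Measure.prod_prod, Measure.pi_pi, Measure.pi_pi, ← Finset.prod_mul_distrib]
  refine Finset.prod_congr rfl fun i _ => ?_
  by_cases hi : i ∈ s
  · simp [hi]
  · simp [hi]

/-- `A_s` of a constant. -/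
theorem coordAvg_const (s : Finset ι) (c : ℝ) (ω : ι → X) :
    coordAvg μ s (fun _ => c) ω = c := by
  unfold coordAvg
  rw [integral_const, smul_eq_mul, Measure.real, measure_univ, ENNReal.toReal_one, one_mul]

/-- `A_∅ G = G`. -/
theorem coordAvg_empty (G : (ι → X) → ℝ) : coordAvg μ ∅ G = G := by
  funext ω
  unfold coordAvg
  simp only [Finset.piecewise_empty]
  rw [integral_const, smul_eq_mul, Measure.real, measure_univ, ENNReal.toReal_one, one_mul]

/-- `A_s A_s = A_s`. -/
theorem coordAvg_coordAvg (s : Finset ι) (G : (ι → X) → ℝ) :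
    coordAvg μ s (coordAvg μ s G) = coordAvg μ s G := by
  funext ω
  change (∫ ω', coordAvg μ s G (s.piecewise ω' ω) ∂Measure.pi (fun _ : ι => μ)) = coordAvg μ s G ω
  simp_rw [coordAvg_apply_piecewise]
  rw [integral_const, smul_eq_mul, Measure.real, measure_univ, ENNReal.toReal_one, one_mul]

end CoordAvg

/-! ## §2 Coordinate averages of continuous functions on a compact product -/

section Continuous

variable [MetricSpace X] [CompactSpace X] [BorelSpace X]

omit [Fintype ι] [MeasurableSpace X] [CompactSpace X] [BorelSpace X] in
/-- Gluing two configurations along `s` is continuous (jointly). -/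
theorem continuous_piecewise_prod (s : Finset ι) :
    Continuous fun p : (ι → X) × (ι → X) => s.piecewise p.2 p.1 := by
  refine continuous_pi fun i => ?_
  by_cases hi : i ∈ s
  · simp only [Finset.piecewise_eq_of_mem _ _ _ hi]
    exact (continuous_apply i).comp continuous_snd
  · simp only [Finset.piecewise_eq_of_notMem _ _ _ hi]
    exact (continuous_apply i).comp continuous_fst

omit [Fintype ι] [MeasurableSpace X] [CompactSpace X] [BorelSpace X] in
/-- Updating one coordinate is continuous in the new value. -/
theorem continuous_update_right (ω : ι → X) (k : ι) : Continuous fun v : X => update ω k v :=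
  continuous_pi fun i => by
    by_cases hi : i = k
    · subst hi
      simp only [update_self]
      exact continuous_id'
    · simp only [update_of_ne hi]
      exact continuous_const

omit [DecidableEq ι] in
/-- A continuous function on the compact configuration space is integrable for the (finite)
product measure. -/
theorem integrable_pi_of_continuous (μ : Measure X) [IsFiniteMeasure μ] {G : (ι → X) → ℝ}
    (hG : Continuous G) : Integrable G (Measure.pi (fun _ : ι => μ)) :=
  hG.integrable_of_hasCompactSupport (HasCompactSupport.of_compactSpace _)

variable (μ : Measure X) [IsProbabilityMeasure μ]

/-- **`A_s G` is continuous** for continuous `G` (parametric integral over a compact space). -/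
theorem continuous_coordAvg (s : Finset ι) {G : (ι → X) → ℝ} (hG : Continuous G) :
    Continuous (coordAvg μ s G) := by
  have hf : Continuous (uncurry fun (ω : ι → X) (ω' : ι → X) => G (s.piecewise ω' ω)) :=
    hG.comp (continuous_piecewise_prod s)
  have h := continuous_parametric_integral_of_continuous (μ := Measure.pi (fun _ : ι => μ)) hf
    isCompact_univ
  simp only [Measure.restrict_univ] at h
  exact h

/-- **`E[A_s G] = E[G]`**: coordinate averaging preserves the mean. -/
theorem integral_coordAvg (s : Finset ι) {G : (ι → X) → ℝ} (hG : Continuous G) :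
    ∫ ω, coordAvg μ s G ω ∂Measure.pi (fun _ : ι => μ) = ∫ ω, G ω ∂Measure.pi (fun _ : ι => μ) := by
  have hint : Integrable (fun p : (ι → X) × (ι → X) => G (s.piecewise p.2 p.1))
      ((Measure.pi (fun _ : ι => μ)).prod (Measure.pi (fun _ : ι => μ))) :=
    (hG.comp (continuous_piecewise_prod s)).integrable_of_hasCompactSupport
      (HasCompactSupport.of_compactSpace _)
  unfold coordAvg
  rw [← integral_prod _ hint, ← integral_map (measurable_piecewise_prod s).aemeasurable
    hG.aestronglyMeasurable, map_piecewise_pi_prod]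

/-- `A_s` is additive (continuous integrands). -/
theorem coordAvg_sub (s : Finset ι) {G H : (ι → X) → ℝ} (hG : Continuous G) (hH : Continuous H)
    (ω : ι → X) :
    coordAvg μ s (fun ω => G ω - H ω) ω = coordAvg μ s G ω - coordAvg μ s H ω := by
  unfold coordAvg
  have hc : Continuous fun ω' : ι → X => s.piecewise ω' ω :=
    (continuous_piecewise_prod s).comp (Continuous.prodMk_right ω)
  exact integral_sub (integrable_pi_of_continuous μ (hG.comp hc))
    (integrable_pi_of_continuous μ (hH.comp hc))

omit [CompactSpace X] in
/-- **`A_k G(ω) = ∫ G(ω[k ← v]) dμ(v)`**: averaging over one coordinate. -/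
theorem coordAvg_singleton (k : ι) {G : (ι → X) → ℝ} (hG : Continuous G) (ω : ι → X) :
    coordAvg μ {k} G ω = ∫ v, G (update ω k v) ∂μ := by
  unfold coordAvg
  simp only [Finset.piecewise_singleton]
  have hev := (measurePreserving_eval (fun _ : ι => μ) k).map_eq
  have hc : Continuous fun v : X => G (update ω k v) := hG.comp (continuous_update_right ω k)
  have h1 : ∫ v, G (update ω k v) ∂μ =
      ∫ v, G (update ω k v) ∂(Measure.map (eval k) (Measure.pi fun _ : ι => μ)) := by
    rw [hev]
  rw [h1, integral_map (measurable_pi_apply k).aemeasurable hc.aestronglyMeasurable]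

/-- **Independence: `A_{s ∪ {k}} = A_s ∘ A_k`** for `k ∉ s` (the `k`-th coordinate of a
`π`-sample is independent of its `s`-coordinates: redraw it, `LatticeSiteResampling`). -/
theorem coordAvg_insert {k : ι} {s : Finset ι} (hk : k ∉ s) {G : (ι → X) → ℝ} (hG : Continuous G)
    (ω : ι → X) :
    coordAvg μ (insert k s) G ω = coordAvg μ s (coordAvg μ {k} G) ω := by
  have huniv : (fun _ : ι => μ) k Set.univ ≠ 0 := by simp
  -- left: redraw coordinate `k` of `ω'`
  have hcont : Continuous fun ω' : ι → X => G ((insert k s).piecewise ω' ω) :=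
    hG.comp ((continuous_piecewise_prod (insert k s)).comp (Continuous.prodMk_right ω))
  have hL := integral_pi_eq_integral_integral_update' (fun _ : ι => μ) k huniv
    (integrable_pi_of_continuous μ hcont)
  simp only [measure_univ, inv_one, ENNReal.toReal_one, one_smul] at hL
  -- the glued configuration after redrawing
  have hglue : ∀ (ω' : ι → X) (v : X),
      (insert k s).piecewise (update ω' k v) ω = update (s.piecewise ω' ω) k v := by
    intro ω' v
    rw [Finset.piecewise_insert, update_self]
    congr 1
    exact s.piecewise_congr (fun i hi => update_of_ne (ne_of_mem_of_not_mem hi hk) _ _)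
      fun _ _ => rfl
  unfold coordAvg
  rw [hL]
  refine integral_congr_ae (ae_of_all _ fun ω' => ?_)
  simp only [hglue]
  rw [show (∫ ω'', G (({k} : Finset ι).piecewise ω'' (s.piecewise ω' ω))
      ∂Measure.pi fun _ : ι => μ) = coordAvg μ {k} G (s.piecewise ω' ω) from rfl,
    coordAvg_singleton μ k hG]

omit [DecidableEq ι] in
/-- On a probability space, `∫ (h − ∫h)² = ∫ h² − (∫ h)²` (continuous `h` on the compact product). -/
theorem integral_sq_sub_mean {h : (ι → X) → ℝ} (hc : Continuous h) :
    ∫ ω', (h ω' - ∫ ω'', h ω'' ∂Measure.pi (fun _ : ι => μ)) ^ 2 ∂Measure.pi (fun _ : ι => μ) =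
      ∫ ω', h ω' ^ 2 ∂Measure.pi (fun _ : ι => μ) -
        (∫ ω', h ω' ∂Measure.pi (fun _ : ι => μ)) ^ 2 := by
  set c := ∫ ω'', h ω'' ∂Measure.pi (fun _ : ι => μ) with hcdef
  have hi : Integrable h (Measure.pi fun _ : ι => μ) := integrable_pi_of_continuous μ hc
  have hi2 : Integrable (fun ω' => h ω' ^ 2) (Measure.pi fun _ : ι => μ) :=
    integrable_pi_of_continuous μ (hc.pow 2)
  have hB : Integrable (fun ω' => 2 * c * h ω') (Measure.pi fun _ : ι => μ) := hi.const_mul _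
  have hA : Integrable (fun ω' => h ω' ^ 2 - 2 * c * h ω') (Measure.pi fun _ : ι => μ) :=
    hi2.sub hB
  have hfun : (fun ω' => (h ω' - c) ^ 2) = fun ω' => h ω' ^ 2 - 2 * c * h ω' + c ^ 2 := by
    funext ω'; ring
  rw [hfun, integral_add hA (integrable_const _), integral_sub hi2 hB, integral_const_mul,
    integral_const, smul_eq_mul, Measure.real, measure_univ, ENNReal.toReal_one, one_mul, ← hcdef]
  ring

/-- **Jensen for `A_s`**: `(A_s H)² ≤ A_s(H²)` pointwise. -/
theorem sq_coordAvg_le (s : Finset ι) {H : (ι → X) → ℝ} (hH : Continuous H) (ω : ι → X) :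
    coordAvg μ s H ω ^ 2 ≤ coordAvg μ s (fun ω => H ω ^ 2) ω := by
  have hc : Continuous fun ω' : ι → X => H (s.piecewise ω' ω) :=
    hH.comp ((continuous_piecewise_prod s).comp (Continuous.prodMk_right ω))
  have hnn : 0 ≤ ∫ ω', (H (s.piecewise ω' ω) -
      ∫ ω'', H (s.piecewise ω'' ω) ∂Measure.pi (fun _ : ι => μ)) ^ 2 ∂Measure.pi (fun _ : ι => μ) :=
    integral_nonneg fun ω' => sq_nonneg _
  rw [integral_sq_sub_mean μ hc] at hnn
  unfold coordAvg
  linarith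

/-- **Orthogonality**: `E[(G − A_s G) · Φ] = 0` for every continuous `Φ` not depending on the
`s`-coordinates. -/
theorem integral_sub_coordAvg_mul_eq_zero (s : Finset ι) {G Φ : (ι → X) → ℝ} (hG : Continuous G)
    (hΦ : Continuous Φ) (hΦs : ∀ ω ω', Φ (s.piecewise ω' ω) = Φ ω) :
    ∫ ω, (G ω - coordAvg μ s G ω) * Φ ω ∂Measure.pi (fun _ : ι => μ) = 0 := by
  have hA : Continuous (coordAvg μ s G) := continuous_coordAvg μ s hG
  have hD : Continuous fun ω => G ω - coordAvg μ s G ω := hG.sub hA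
  have hm : Continuous fun ω => Φ ω * (G ω - coordAvg μ s G ω) := hΦ.mul hD
  calc ∫ ω, (G ω - coordAvg μ s G ω) * Φ ω ∂Measure.pi (fun _ : ι => μ)
      = ∫ ω, Φ ω * (G ω - coordAvg μ s G ω) ∂Measure.pi (fun _ : ι => μ) :=
        integral_congr_ae (ae_of_all _ fun ω => mul_comm _ _)
    _ = ∫ ω, coordAvg μ s (fun ω => Φ ω * (G ω - coordAvg μ s G ω)) ω ∂Measure.pi (fun _ : ι => μ) :=
        (integral_coordAvg μ s hm).symm
    _ = ∫ ω, Φ ω * (coordAvg μ s G ω - coordAvg μ s (coordAvg μ s G) ω) ∂Measure.pi (fun _ : ι => μ) := by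
        refine integral_congr_ae (ae_of_all _ fun ω => ?_)
        simp only
        rw [coordAvg_mul_left μ s hΦs, coordAvg_sub μ s hG hA]
    _ = 0 := by simp [coordAvg_coordAvg]

end Continuous

end Summit.Ventures.LatticeQCDFlow.Exactness

end
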